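import Mathlib
import HarnessLib
import Literature.MathematicalPhysics.QuantumLattice.KohnLuttingerLindhardL2Bound
import Literature.MathematicalPhysics.QuantumLattice.KohnLuttingerFermiCurvePolarIntegral
import Literature.MathematicalPhysics.QuantumLattice.HubbardPairEnergySublevel
import Literature.MathematicalPhysics.QuantumLattice.HubbardBandShellVolume
import Summits.HubbardSuperconductivity.HubbardSuperconductivity.Theorems.WeakCouplingBCSWcbcsKohnLuttingerB1gReduction

/-!
# `stub_klKernelHS`: the Lindhard kernel on `F_μ × F_μ` is Hilbert–Schmidt for the density-of-states measure

Crux `CwKLChiralWindow` (stmt-HubbardSuperconductivity-1741), line `Sketch`, stub (K).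

For `ε₀ = squareDispersion 1 0` and `μ ∈ (-4, 0)` the kernel `(k, k') ↦ χ₀(k + k'; μ)`
(`χ₀ = lindhardFunction ε₀ μ`) is square integrable for `σ_μ ⊗ σ_μ`,
`σ_μ = fermiCurveMeasure ε₀ μ`. This is a TRANSPORT of the landed polar statement
`Literature…memLp_lindhardKernelPolar` (`(θ, θ') ↦ χ₀(γθ + γθ')` is in `L²(dθ dθ' ⌞ (-π,π]²)`,
`γ = fermiPolar μ`, given the torus-sublevel and shell-volume estimates
`exists_torusSublevel_le`, `exists_shellVolume_le`) through the polar description of the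
Fermi-curve measure `σ_μ = γ_* (w dθ ⌞ (-π,π])` (`fermiCurveMeasure_eq_map`,
`w = fermiPolarDOS μ ≤ w₁` by `exists_bounds_fermiPolarDOS`):

* `σ_μ ≤ w₁ • γ_* dθ` (`klhs_kernel_fermiCurveMeasure_le`), hence
  `σ_μ ⊗ σ_μ ≤ w₁² • (γ × γ)_* (dθ ⊗ dθ')` (`Measure.prod_mono`, `Measure.map_prod_map`);
* `χ₀(· + ·) ∈ L²((γ × γ)_* (dθ ⊗ dθ'))` iff the polar kernel is in `L²(dθ dθ')`
  (`memLp_map_measure_iff`), and `MemLp` passes to a measure dominated by a finite multiple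
  (`MemLp.of_measure_le_smul`).
-/

noncomputable section

set_option linter.dupNamespace false

namespace Summit.HubbardSuperconductivity.HubbardSuperconductivity.Theorems

open MeasureTheory Literature.MathematicalPhysics.QuantumLattice
open scoped ENNReal

section KernelHS

variable {μ : ℝ} (hμ₁ : -4 < μ) (hμ₂ : μ < 0)
include hμ₁ hμ₂

/-- **The polar Lindhard kernel is in `L²(dθ dθ')`** for `-4 < μ < 0`, unconditionally: the
torus-sublevel and shell-volume hypotheses of `memLp_lindhardKernelPolar` are supplied by
`exists_torusSublevel_le` and `exists_shellVolume_le` on the degenerate band `[μ, μ]`. [folklore] -/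
theorem klhs_kernel_memLp_polar :
    MemLp (fun z : ℝ × ℝ => lindhardFunction (squareDispersion 1 0) μ (fermiPolar μ z.1 + fermiPolar μ z.2)) 2
      ((volume.restrict (Set.Ioc (-Real.pi) Real.pi)).prod (volume.restrict (Set.Ioc (-Real.pi) Real.pi))) := by
  obtain ⟨C, β, hC, hβ0, hβ2, hTSL⟩ := exists_torusSublevel_le (μ₁ := μ) (μ₂ := μ) hμ₁ hμ₂
  obtain ⟨Csh, hCsh, hSV⟩ := exists_shellVolume_le (μ₁ := μ) (μ₂ := μ) hμ₁ hμ₂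
  have hμI : μ ∈ Set.Icc μ μ := ⟨le_rfl, le_rfl⟩
  exact memLp_lindhardKernelPolar hμ₁ hμ₂ hC hβ0 hβ2 hCsh (hTSL μ hμI) (hSV μ hμI)

/-- **Domination of the Fermi-curve measure by the pushed-forward angle measure**:
`σ_μ ≤ w₁ • γ_* (dθ ⌞ (-π,π])` whenever `fermiPolarDOS μ ≤ w₁`. [folklore] -/
theorem klhs_kernel_fermiCurveMeasure_le {w₁ : ℝ} (hw : ∀ θ, fermiPolarDOS μ θ ≤ w₁) :
    fermiCurveMeasure (squareDispersion 1 0) μ ≤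
      ENNReal.ofReal w₁ • Measure.map (fermiPolar μ) (volume.restrict (Set.Ioc (-Real.pi) Real.pi)) := by
  have hFm : Measurable (fermiPolar μ) := (continuous_fermiPolar hμ₁ hμ₂).measurable
  rw [fermiCurveMeasure_eq_map hμ₁ hμ₂]
  calc Measure.map (fermiPolar μ) ((volume.restrict (Set.Ioc (-Real.pi) Real.pi)).withDensity fun θ =>
          ENNReal.ofReal (fermiPolarDOS μ θ))
      ≤ Measure.map (fermiPolar μ) ((volume.restrict (Set.Ioc (-Real.pi) Real.pi)).withDensity fun _ =>
          ENNReal.ofReal w₁) :=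
        Measure.map_mono (withDensity_mono (Filter.Eventually.of_forall fun θ =>
          ENNReal.ofReal_le_ofReal (hw θ))) hFm
    _ = ENNReal.ofReal w₁ • Measure.map (fermiPolar μ) (volume.restrict (Set.Ioc (-Real.pi) Real.pi)) := by
        rw [withDensity_const, Measure.map_smul]

/-- **(K) at a fixed level**: for `-4 < μ < 0` the kernel `(k, k') ↦ χ₀(k + k'; μ)` is in
`L²(σ_μ ⊗ σ_μ)` (pull back to the angles through `γ × γ`, where it is the polar kernel of
`klhs_kernel_memLp_polar`, and compare `σ_μ ⊗ σ_μ ≤ w₁² • (γ × γ)_* (dθ ⊗ dθ')`). [folklore] -/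
theorem klhs_kernel_memLp :
    MemLp (fun z : Momentum × Momentum => lindhardFunction (squareDispersion 1 0) μ (z.1 + z.2)) 2
      ((fermiCurveMeasure (squareDispersion 1 0) μ).prod (fermiCurveMeasure (squareDispersion 1 0) μ)) := by
  obtain ⟨w₀, w₁, -, hw⟩ := exists_bounds_fermiPolarDOS hμ₁ hμ₂
  have hFm : Measurable (fermiPolar μ) := (continuous_fermiPolar hμ₁ hμ₂).measurable
  have hle := klhs_kernel_fermiCurveMeasure_le hμ₁ hμ₂ (fun θ => (hw θ).2)
  have hfm : Measurable (fun z : Momentum × Momentum => lindhardFunction (squareDispersion 1 0) μ (z.1 + z.2)) :=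
    (measurable_lindhardFunction (measurable_squareDispersion 1 0) μ).comp measurable_add
  have hmap : MemLp (fun z : Momentum × Momentum => lindhardFunction (squareDispersion 1 0) μ (z.1 + z.2)) 2
      (Measure.map (Prod.map (fermiPolar μ) (fermiPolar μ))
        ((volume.restrict (Set.Ioc (-Real.pi) Real.pi)).prod (volume.restrict (Set.Ioc (-Real.pi) Real.pi)))) :=
    (memLp_map_measure_iff hfm.aestronglyMeasurable (hFm.prodMap hFm).aemeasurable).2
      (klhs_kernel_memLp_polar hμ₁ hμ₂)
  refine hmap.of_measure_le_smul (c := ENNReal.ofReal w₁ * ENNReal.ofReal w₁)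
    (ENNReal.mul_ne_top ENNReal.ofReal_ne_top ENNReal.ofReal_ne_top) ?_
  calc (fermiCurveMeasure (squareDispersion 1 0) μ).prod (fermiCurveMeasure (squareDispersion 1 0) μ)
      ≤ (ENNReal.ofReal w₁ • Measure.map (fermiPolar μ) (volume.restrict (Set.Ioc (-Real.pi) Real.pi))).prod
          (ENNReal.ofReal w₁ • Measure.map (fermiPolar μ) (volume.restrict (Set.Ioc (-Real.pi) Real.pi))) :=
        Measure.prod_mono hle hle
    _ = (ENNReal.ofReal w₁ * ENNReal.ofReal w₁) • Measure.map (Prod.map (fermiPolar μ) (fermiPolar μ))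
          ((volume.restrict (Set.Ioc (-Real.pi) Real.pi)).prod (volume.restrict (Set.Ioc (-Real.pi) Real.pi))) := by
        rw [Measure.prod_smul_left, Measure.prod_smul_right, Measure.map_prod_map _ _ hFm hFm, smul_smul]

end KernelHS

/-- **(K) Hilbert–Schmidt kernel.** For `-4 < μ < 0` the Lindhard kernel `(k, k') ↦ χ₀(k + k'; μ)`
is square integrable for `σ_μ ⊗ σ_μ` (`σ_μ = fermiCurveMeasure ε₀ μ`). Transport of
`Literature…memLp_lindhardKernelPolar` through `fermiCurveMeasure_eq_map` and
`exists_bounds_fermiPolarDOS` (`klhs_kernel_memLp`). [folklore] -/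
theorem stub_klKernelHS :
    ∀ μ ∈ Set.Ioo (-4 : ℝ) 0,
      MemLp (fun z : Momentum × Momentum => lindhardFunction (squareDispersion 1 0) μ (z.1 + z.2)) 2
        ((fermiCurveMeasure (squareDispersion 1 0) μ).prod (fermiCurveMeasure (squareDispersion 1 0) μ)) :=
  fun _ hμ => klhs_kernel_memLp hμ.1 hμ.2

end Summit.HubbardSuperconductivity.HubbardSuperconductivity.Theorems

end
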